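import Summits.CriticalPhenomena.PercolationContinuityZ3.Theorems.PercFiniteBoxLROLinearScaleLROOfThetaShellToolsAspect
import HarnessLib

/-!
# `PercFiniteBoxLRO.LinearScaleLROOfTheta` (stmt-CriticalPhenomena-0855): Cerf's missing estimate
# follows from positive-probability uniqueness of the crossings of shells of ANY FIXED ASPECT RATIO
# at `p_c(ℤ³)`

Helper file (`--supports stmt-CriticalPhenomena-0855`) of line `registered` (lead c1); the
aspect-ratio-free form of `PercFiniteBoxLROLinearScaleLROOfThetaShellUniq.lean`.  Notation:
`P = P_{p_c}` bond percolation on `ℤ³`, `Λ_m = box 3 m`, `∂ⁱⁿΛ_m` the sphere `‖x‖_∞ = m`.  For an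
integer aspect ratio `l ≥ 2` and `k ∈ ℕ` the shell `Λ_{l(k+1)} ∖ Λ_k = {k+1 ≤ ‖x‖_∞ ≤ l(k+1)}`; its
*uniqueness event* `U^l_k`: any two sites of `∂ⁱⁿΛ_{k+1}` joined INSIDE the shell to `∂ⁱⁿΛ_{l(k+1)}`
are joined to each other inside the shell (at most one crossing cluster).

**Theorem** (`linearScaleLROOfTheta_of_shellUniqPos_aspect`).  If for SOME `l ≥ 2` and `δ > 0`,
`P_{p_c}(U^l_k) ≥ δ` for all large `k`, then `LinearScaleLROOfTheta` (Cerf 2015, arXiv:1306.3105,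
p. 4).  The larger `l`, the weaker the hypothesis (crossing clusters of thicker shells are fewer):
at aspect ratio `n^{42}` the two-cluster probability even tends to `0` (Cerf 2015 Thm 1.2,
quantitative AKN uniqueness); the hypothesis asks, at one bounded aspect ratio, only for probability
bounded away from `0`.  It is OPEN (a θ-free thinness statement of hyperscaling type, believed for
`d = 3`, false for `d > 6`).

Proof: as at aspect ratio `2` — if `θ := θ(p_c) > 0` and `P(0 ↔ n e₀ inside Λ_{Kn}) < θ²/2`, then
with probability `> θ²/2` the sites `0`, `n e₀` percolate without being joined inside `Λ_{Kn}`
(Harris–FKG); their arms split each of the `J` pairwise disjoint shells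
`Λ_{l m_j} ∖ Λ_{m_j - 1}`, `m_j = (2l)^{j+1} n`, `j < J` (`ShellUniq.shell_split_gen`), whose
uniqueness events are determined by disjoint edge sets and hence independent, so
`θ²/2 < (1-δ)^J` — absurd for `J` large; small `n` by AKN pointwise local uniqueness and Cerf's
Lemma 10.1; then the landed `linearScaleLROOfTheta_of_criticalFloor`.

## References

* R. Cerf, Ann. Probab. 43 (2015) 2458–2480, arXiv:1306.3105, p. 4, Thm 1.2, §10 [Cerf2015].
* M. Aizenman, Nucl. Phys. B 485 (1997) 551–582 [Aizenman1997].
* G. Grimmett, *Percolation*, 2nd ed. (1999), Thm (2.4), §2.2 [GrimmettPercolation1999].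
-/

noncomputable section

namespace Summit.CriticalPhenomena.PercolationContinuityZ3.Theorems

namespace ShellUniq

open Literature.Probability.Percolation Literature.Probability.LatticeModels
open Literature.Probability.Percolation.DCT16
open MeasureTheory Filter Set
open scoped Topology ENNReal

/-- **Positive-probability uniqueness of the crossings of shells of a fixed aspect ratio ⟹ the
critical one-site floor.**  If for some `l ≥ 2`, `δ > 0` and all `k ≥ k₀` the uniqueness event of the
shell `Λ_{l(k+1)} ∖ Λ_k` has `P_{p_c}`-probability `≥ δ`, then `θ(p_c) > 0` implies: for some
`ρ₀ > 0`, `K ≥ 1` and every `n ≥ 1`, `P_{p_c}(0 ↔ n e₀ inside Λ_{Kn}) ≥ ρ₀`.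
[cite: Cerf2015, p. 4 and §10] -/
theorem criticalFloor_of_shellUniqPos_aspect
    (hU : ∃ l : ℕ, 2 ≤ l ∧ ∃ δ : ℝ, 0 < δ ∧ ∃ k₀ : ℕ, ∀ k : ℕ, k₀ ≤ k →
      δ ≤ (bondPercolation (zdGraph 3) (criticalProbI 3)).real {ω : BondConfig (Site 3) |
        ∀ a ∈ innerBoundary (zdGraph 3) (box 3 (k + 1)), ∀ a' ∈ innerBoundary (zdGraph 3) (box 3 (k + 1)),
          (∃ b ∈ innerBoundary (zdGraph 3) (box 3 (l * (k + 1))),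
              ω ∈ openConnIn (↑(box 3 (l * (k + 1)) \ box 3 k) : Set (Site 3)) a b) →
            (∃ b' ∈ innerBoundary (zdGraph 3) (box 3 (l * (k + 1))),
              ω ∈ openConnIn (↑(box 3 (l * (k + 1)) \ box 3 k) : Set (Site 3)) a' b') →
              ω ∈ openConnIn (↑(box 3 (l * (k + 1)) \ box 3 k) : Set (Site 3)) a a'})
    (hθ : 0 < theta (zdGraph 3) (0 : Site 3) (criticalProbI 3)) :
    ∃ ρ₀ : ℝ, 0 < ρ₀ ∧ ∃ K : ℕ, 1 ≤ K ∧ ∀ n : ℕ, 1 ≤ n →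
      ∃ x ∈ innerBoundary (zdGraph 3) (box 3 n),
        ρ₀ ≤ (bondPercolation (zdGraph 3) (criticalProbI 3)).real
          (openConnIn (↑(box 3 (K * n)) : Set (Site 3)) (0 : Site 3) x) := by
  classical
  set p : unitInterval := criticalProbI 3 with hp
  set μ := bondPercolation (zdGraph 3) p with hμ
  set θ₀ : ℝ := theta (zdGraph 3) (0 : Site 3) p with hθ₀
  obtain ⟨l, hl, δ, hδ, k₀, hk₀⟩ := hU
  -- the shell-uniqueness events at aspect ratio `l`, as a family
  set U : ℕ → Set (BondConfig (Site 3)) := fun k => {ω : BondConfig (Site 3) |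
        ∀ a ∈ innerBoundary (zdGraph 3) (box 3 (k + 1)), ∀ a' ∈ innerBoundary (zdGraph 3) (box 3 (k + 1)),
          (∃ b ∈ innerBoundary (zdGraph 3) (box 3 (l * (k + 1))),
              ω ∈ openConnIn (↑(box 3 (l * (k + 1)) \ box 3 k) : Set (Site 3)) a b) →
            (∃ b' ∈ innerBoundary (zdGraph 3) (box 3 (l * (k + 1))),
              ω ∈ openConnIn (↑(box 3 (l * (k + 1)) \ box 3 k) : Set (Site 3)) a' b') →
              ω ∈ openConnIn (↑(box 3 (l * (k + 1)) \ box 3 k) : Set (Site 3)) a a'} with hUdef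
  have hUk : ∀ k, k₀ ≤ k → δ ≤ μ.real (U k) := fun k hk => hk₀ k hk
  have hθ2 : 0 < θ₀ ^ 2 := by positivity
  have hδ1 : δ ≤ 1 := (hUk k₀ le_rfl).trans measureReal_le_one
  obtain ⟨J, hJ⟩ := exists_pow_lt_of_lt_one (show 0 < θ₀ ^ 2 / 4 by positivity)
    (show 1 - δ < 1 by linarith)
  -- small scales: AKN pointwise local uniqueness at the axis sites
  set ε : ℝ≥0∞ := ENNReal.ofReal (θ₀ ^ 2 / 4) with hε
  have hεpos : 0 < ε := by rw [hε, ENNReal.ofReal_pos]; positivity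
  have hev : ∀ n ∈ Finset.range (k₀ + 1), ∀ᶠ j : ℕ in atTop,
      μ (badPair (n + j) (0 : Site 3) (Pi.single 0 (n : ℤ))) < ε := fun n _ =>
    (tendsto_measure_badPair p (zero_mem_box 3 n) (LinearScaleLROReduction.single_mem_box n)).eventually
      (gt_mem_nhds hεpos)
  obtain ⟨j₀, hj₀⟩ := ((Finset.eventually_all (Finset.range (k₀ + 1))).2 hev).exists_forall_of_atTop
  -- the box factor
  set K : ℕ := max (l * (2 * l) ^ J) (j₀ + 1) with hK
  have hK1 : 1 ≤ K := le_trans (by omega) (le_max_right _ _)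
  have hKJ : l * (2 * l) ^ J ≤ K := le_max_left _ _
  have hKj : j₀ + 1 ≤ K := le_max_right _ _
  refine ⟨θ₀ ^ 2 / 2, by positivity, K, hK1, fun n hn =>
    ⟨Pi.single 0 (n : ℤ), LinearScaleLROReduction.single_mem_innerBoundary n, ?_⟩⟩
  set v : Site 3 := Pi.single 0 (n : ℤ) with hv
  by_contra hlt
  rw [not_le] at hlt
  rcases lt_or_ge n (k₀ + 1) with hsmall | hlarge
  · -- small scale `n ≤ k₀`
    obtain ⟨j, hj⟩ : ∃ j, K * n = n + j := Nat.exists_eq_add_of_le (Nat.le_mul_of_pos_left n (by omega))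
    have h1 : (j₀ + 1) * n ≤ K * n := Nat.mul_le_mul_right n hKj
    rw [add_mul, one_mul] at h1
    have h2 : j₀ ≤ j₀ * n := Nat.le_mul_of_pos_right j₀ (by omega)
    have hjge : j₀ ≤ j := by omega
    have hlt' := hj₀ j hjge n (Finset.mem_range.2 hsmall)
    have hreal : μ.real (badPair (n + j) (0 : Site 3) v) ≤ θ₀ ^ 2 / 4 := by
      rw [measureReal_def]
      have h := ENNReal.toReal_mono ENNReal.ofReal_ne_top hlt'.le
      rwa [ENNReal.toReal_ofReal (by positivity)] at h
    have hvbox : v ∈ box 3 (n + j) := box_mono 3 (by omega) (LinearScaleLROReduction.single_mem_box n)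
    have h10 := LinearScaleLROReduction.cerf_lemma_10_1 p (zero_mem_box 3 (n + j)) hvbox
    rw [hj] at hlt
    linarith
  · -- large scale: the split event and the `J` disjoint shells `Λ_{l m_j} ∖ Λ_{m_j - 1}`
    have hn1 : 1 ≤ n := hn
    set E : Set (BondConfig (Site 3)) :=
      (percolatesAt (0 : Site 3) ∩ percolatesAt v) \ openConnIn (↑(box 3 (K * n)) : Set (Site 3)) 0 v
      with hE
    have hfkg : θ₀ ^ 2 ≤ μ.real (percolatesAt (0 : Site 3) ∩ percolatesAt v) := by
      have h := harris_fkg_holds (zdGraph 3) p (isUpperSet_percolatesAt (0 : Site 3))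
        (isUpperSet_percolatesAt v) (measurableSet_percolatesAt_holds (0 : Site 3))
        (measurableSet_percolatesAt_holds v)
      have hθv : μ.real (percolatesAt v) = θ₀ := theta_zdGraph_eq_theta_zero p v
      have hθ0 : μ.real (percolatesAt (0 : Site 3)) = θ₀ := rfl
      rw [hθv, hθ0] at h
      nlinarith [h]
    have hEge : θ₀ ^ 2 / 2 < μ.real E := by
      have hsub : percolatesAt (0 : Site 3) ∩ percolatesAt v ⊆
          E ∪ openConnIn (↑(box 3 (K * n)) : Set (Site 3)) 0 v := by
        intro ω hω
        by_cases hc : ω ∈ openConnIn (↑(box 3 (K * n)) : Set (Site 3)) 0 v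
        · exact Or.inr hc
        · exact Or.inl ⟨hω, hc⟩
      have h1 : μ.real (percolatesAt (0 : Site 3) ∩ percolatesAt v) ≤
          μ.real E + μ.real (openConnIn (↑(box 3 (K * n)) : Set (Site 3)) 0 v) :=
        (measureReal_mono hsub).trans (measureReal_union_le _ _)
      linarith
    -- the scales `m j = (2l)^{j+1} n`, inner radii `k j + 1 = m j`, outer radii `q j + 1 = l m j`
    have h2l : 1 ≤ 2 * l := by omega
    set m : ℕ → ℕ := fun j => (2 * l) ^ (j + 1) * n with hm
    have hm_succ : ∀ j, m (j + 1) = 2 * l * m j := fun j => by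
      show (2 * l) ^ (j + 1 + 1) * n = 2 * l * ((2 * l) ^ (j + 1) * n)
      rw [pow_succ]; ring
    have hm_mono : ∀ i j, i ≤ j → m i ≤ m j := fun i j hij =>
      Nat.mul_le_mul_right n (Nat.pow_le_pow_right h2l (by omega))
    have hm0 : n + 1 ≤ m 0 := by
      show n + 1 ≤ (2 * l) ^ (0 + 1) * n
      rw [zero_add, pow_one]
      nlinarith
    have hm1 : ∀ j, n + 1 ≤ m j := fun j => hm0.trans (hm_mono 0 j (Nat.zero_le j))
    set k : ℕ → ℕ := fun j => m j - 1 with hk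
    have hk1 : ∀ j, k j + 1 = m j := fun j => Nat.sub_add_cancel (by have := hm1 j; omega)
    have hnk : ∀ j, n ≤ k j := fun j => by have := hm1 j; have := hk1 j; omega
    set q : ℕ → ℕ := fun j => l * m j - 1 with hq
    have hlm1 : ∀ j, 1 ≤ l * m j := fun j =>
      Nat.one_le_iff_ne_zero.2 (Nat.mul_ne_zero (by omega) (by have := hm1 j; omega))
    have hq1 : ∀ j, q j + 1 = l * (k j + 1) := fun j => by
      rw [hk1 j]; exact Nat.sub_add_cancel (hlm1 j)
    have hkq : ∀ j, k j < q j := fun j => by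
      have h1 : m j + m j ≤ l * m j := by nlinarith [hm1 j]
      have h2 := hk1 j
      have h3 : q j + 1 = l * m j := by rw [hq1 j, hk1 j]
      have h4 := hm1 j
      omega
    -- shells with `j < J` fit inside `Λ_{Kn}`
    have hfit : ∀ j, j < J → q j + 1 ≤ K * n := fun j hj => by
      rw [hq1 j, hk1 j]
      show l * ((2 * l) ^ (j + 1) * n) ≤ K * n
      have h4 : (2 * l) ^ (j + 1) ≤ (2 * l) ^ J := Nat.pow_le_pow_right h2l hj
      calc l * ((2 * l) ^ (j + 1) * n) = (l * (2 * l) ^ (j + 1)) * n := by ring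
        _ ≤ (l * (2 * l) ^ J) * n := Nat.mul_le_mul_right n (Nat.mul_le_mul_left l h4)
        _ ≤ K * n := Nat.mul_le_mul_right n hKJ
    -- disjointness of the shells
    set F : ℕ → Finset (Sym2 (Site 3)) := fun j => (box 3 (l * (k j + 1)) \ box 3 (k j)).sym2 with hF
    have hshell_disj : ∀ i j, i < j → Disjoint (box 3 (l * (k i + 1)) \ box 3 (k i))
        (box 3 (l * (k j + 1)) \ box 3 (k j)) := by
      intro i j hij
      rw [Finset.disjoint_left]
      intro z hzi hzj
      rw [Finset.mem_sdiff] at hzi hzj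
      apply hzj.2
      refine box_mono 3 ?_ hzi.1
      -- `l m_i ≤ m_j - 1`
      rw [hk1 i]
      have h1 : m (i + 1) ≤ m j := hm_mono (i + 1) j hij
      rw [hm_succ i] at h1
      have h2 := hlm1 i
      have h3 := hk1 j
      set t := l * m i with ht
      have h4 : 2 * l * m i = 2 * t := by rw [ht]; ring
      rw [h4] at h1
      show t ≤ k j
      omega
    have hFdisj : ∀ i j, i < j → j < J → Disjoint (F i) (F j) := by
      intro i j hij _
      rw [Finset.disjoint_left]
      intro e hei hej
      induction e using Sym2.ind with
      | h x y =>
        rw [hF, Finset.mk_mem_sym2_iff] at hei hej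
        exact Finset.disjoint_left.1 (hshell_disj i j hij) hei.1 hej.1
    -- on the split event every uniqueness event `U (k j)`, `j < J`, fails
    have hEsub : μ.real E ≤ μ.real (⋂ j ∈ Finset.range J, (U (k j))ᶜ) := by
      refine real_mono_of_forall_subset_edgeSet (zdGraph 3) p fun ω hω hωE => ?_
      simp only [Set.mem_iInter, Finset.mem_range]
      intro j hj
      obtain ⟨⟨h0, hvp⟩, hnc⟩ := hωE
      obtain ⟨a, ha, a', ha', hab, ha'b', hnaa'⟩ :=
        shell_split_gen (hkq j) (hfit j hj) hω
          (box_mono 3 (hnk j) (LinearScaleLROReduction.single_mem_box n)) h0 hvp hnc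
      rw [hq1 j] at hab ha'b' hnaa'
      simp only [hUdef, Set.mem_compl_iff, Set.mem_setOf_eq, not_forall]
      exact ⟨a, ha, a', ha', hab, ha'b', hnaa'⟩
    -- independence: the failures have probability `≤ (1-δ)^J`
    have hdet : ∀ j, DeterminedBy (U (k j)) (↑(F j) : Set (Sym2 (Site 3))) := fun j => by
      have h := determinedBy_shellUniq_gen (k j) (q j)
      rw [hq1 j] at h
      exact h
    have hpow : μ.real (⋂ j ∈ Finset.range J, (U (k j))ᶜ) ≤ (1 - δ) ^ J := by
      refine real_biInter_le_pow p (A := fun j => (U (k j))ᶜ) (F := F) (fun j => ?_) hFdisj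
        (by linarith) fun j hj => ?_
      · have h := hdet j
        rw [determinedBy_iff] at h ⊢
        intro ω ω' hωω'
        rw [Set.mem_compl_iff, Set.mem_compl_iff, h ω ω' hωω']
      · have hmeas : MeasurableSet (U (k j)) := (hdet j).measurableSet_of_finset
        rw [measureReal_compl hmeas, probReal_univ]
        have hkj : k₀ ≤ k j := by have := hnk j; omega
        linarith [hUk (k j) hkj]
    linarith

end ShellUniq

open Literature.Probability.Percolation Literature.Probability.LatticeModels MeasureTheory

/-- **Positive-probability uniqueness of the crossings of shells of SOME fixed aspect ratio at
`p_c(ℤ³)` implies Cerf's missing estimate `X_D`.**  Hypothesis (OPEN; θ-free, hyperscaling type,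
weaker for larger `l`): there are an integer `l ≥ 2`, `δ > 0` and `k₀` such that for every `k ≥ k₀`,
with `P_{p_c}`-probability at least `δ`, any two sites of `∂ⁱⁿΛ_{k+1}` joined inside the shell
`Λ_{l(k+1)} ∖ Λ_k` to `∂ⁱⁿΛ_{l(k+1)}` are joined to each other inside that shell.  Conclusion:
`LinearScaleLROOfTheta`.  Proof: `ShellUniq.criticalFloor_of_shellUniqPos_aspect` and the landed
`linearScaleLROOfTheta_of_criticalFloor`. [cite: Cerf2015, p. 4 and §10] -/
theorem linearScaleLROOfTheta_of_shellUniqPos_aspect :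
    (∃ l : ℕ, 2 ≤ l ∧ ∃ δ : ℝ, 0 < δ ∧ ∃ k₀ : ℕ, ∀ k : ℕ, k₀ ≤ k →
      δ ≤ (bondPercolation (zdGraph 3) (criticalProbI 3)).real {ω : BondConfig (Site 3) |
        ∀ a ∈ innerBoundary (zdGraph 3) (box 3 (k + 1)), ∀ a' ∈ innerBoundary (zdGraph 3) (box 3 (k + 1)),
          (∃ b ∈ innerBoundary (zdGraph 3) (box 3 (l * (k + 1))),
              ω ∈ openConnIn (↑(box 3 (l * (k + 1)) \ box 3 k) : Set (Site 3)) a b) →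
            (∃ b' ∈ innerBoundary (zdGraph 3) (box 3 (l * (k + 1))),
              ω ∈ openConnIn (↑(box 3 (l * (k + 1)) \ box 3 k) : Set (Site 3)) a' b') →
              ω ∈ openConnIn (↑(box 3 (l * (k + 1)) \ box 3 k) : Set (Site 3)) a a'}) →
    Summit.CriticalPhenomena.PercolationContinuityZ3.Theses.PercFiniteBoxLRO.LinearScaleLROOfTheta :=
  fun hU => linearScaleLROOfTheta_of_criticalFloor (ShellUniq.criticalFloor_of_shellUniqPos_aspect hU)

end Summit.CriticalPhenomena.PercolationContinuityZ3.Theorems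

end
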